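import Summits.AnomalousDissipation.AnomalousDissipation.Theorems.SolenoidalFractalHomogenisationLagrangianStepCellClauseModDefs
import Summits.AnomalousDissipation.AnomalousDissipation.Theorems.SolenoidalFractalHomogenisationLagrangianStepFrameDefs
import Literature.Analysis.FluidPDE.LagrangianLatticeCarrierFrame
import Mathlib.Analysis.Calculus.MeanValue

/-!
# K1L_D (stmt-AnomalousDissipation-27980), glue v2 / L5-0: the exact-flow frame `G = (∇X_m)⁻¹` on a refresh window IS a modulation
# (`CellClauseMod.IsModulation`) — the matrix / measure plumbing, with the quantitative window inputs as hypotheses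
(helper, `--supports 27980 --as helper`; prover ad-k1loc-p3 g8 on lead-k1l-onelevel-p1 g5's offer «#14′», tenure-endorsed 2026-08-29T04:14Z)

On the refresh window of level `m+1` starting at `s = j·refresh (m+1)`, for a piece end `t` with `s < t < s + refresh (m+1)`, the modulation
datum of the (V_mod) clause is `G τ y := frameG E m (s + τ/a) s y` (`a = E.a (m+1)`: cell time `τ = a·(window time)`), i.e. the inverse Jacobian
matrix of the coarse flow `X_m(s+u, s)`.  `IsModulation θ (a·(t−s)) nC G` has eight fields; this file proves
* `init` — `X_m(s,s) = id` ⇒ `G 0 = 1` (`IsFlow`: the displacement `∫_s^s` vanishes, so `flowDeriv m s s = id`);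
* `det_one` — `det G = 1` (Liouville, `LevelRegular.det_flowDeriv_eq_one`, and `det A⁻¹ = (det A)⁻¹`);
* `smooth` — every entry of `G` is `Torus.IsSmooth` (`G = adj ∇X` on the window, `LevelRegular.inv_flowDeriv_matrix_eq_adjugate`; the adjugate of a
  `3 × 3` matrix is a polynomial in the entries, `Matrix.adjugate_fin_three`; the entries are smooth, `LevelRegular.isSmooth_flowDeriv_entry`);
* `lipschitz` and `tvar` — from the FRAME EQUATION `∂_u G = −G·(∇b_{≤m}∘X)` (`LevelRegular.hasDerivWithinAt_adjugate_flowDeriv_entry`) and the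
  mean-value theorem: with `|G − 1| ≤ θ` and `|∂_l b_{≤m,q}| ≤ Cb` on the window, `|∂_u G_{il}| ≤ 3(1+θ)·Cb`, so `G` is Lipschitz in `τ` with constant
  `3(1+θ)Cb/a` and the rate `βr ≡ 3(1+θ)Cb/a` has mass `3(1+θ)Cb·(t−s) ≤ θ` (hypothesis `hbudget`);
from THREE QUANTITATIVE WINDOW INPUTS taken as hypotheses (the K3L distortion tower / K8-5 supply them; the lead instantiates `θ := Cα'·E.strain m`):
`hnear` (`|G − 1| ≤ θ` on the window — `…FrameDistortion.abs_frameG_sub_one_le` / `…RegularLWindowDistortion`), `hrate` + `hbudget` (`|∂_l b_{≤m,q}(s+u, X(u,y))| ≤ Cb`,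
`3(1+θ)·Cb·(t−s) ≤ θ` — the Lipschitz constant of `b_{≤m}` is `O(Σ_{i≤m} a_i)` and `(Σ a_i)·refresh (m+1) = strain m`), and the two GEOMETRIC inputs
`hpiola` (columns of `G = adj ∇X` divergence-free — Piola's identity, landed for maps `(ι → ℝ) → (ι → ℝ)` as
`Literature.Analysis.Calculus.sum_fderiv_jacCofactor_eq_zero`; the torus bridge is NOT done here) and `hcurv` (the sharp curvature `|∂_c G_{il}| ≤ θ·nC`,
K8-5 / L12 §5(iii)).  No sorry, no definition, no named fact.  NOT a proof of (V_mod), of `stub_cellInputs`, of K1L_D or of AD; rung F-D1.A0.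
-/

set_option linter.dupNamespace false

noncomputable section

namespace Summit.AnomalousDissipation.AnomalousDissipation.Theorems.SolenoidalFractalHomogenisation.LagrangianStep.FrameForm

open Literature.Analysis Literature.Analysis.FluidPDE Literature.Analysis.FunctionSpaces
open Literature.Analysis.FluidPDE.LatticeShear
open MeasureTheory Set
open scoped NNReal

variable {k : ℕ}

/-! ## §1 `frameJac` is the window Jacobian matrix of the Literature frame file -/

/-- `frameJac` is literally the matrix `(a, c) ↦ (flowDeriv … e_c)_a` of `LagrangianLatticeCarrierFrame`. -/
theorem frameJac_eq_of (E : LagrangianLatticeCarrier k) (m : ℕ) (t w : ℝ) (y : UnitAddTorus (Fin 3)) :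
    frameJac E m t w y = Matrix.of fun a c => (E.flowDeriv m t w y (EuclideanSpace.single c (1 : ℝ))) a := rfl

/-- At the reset time the flow is the identity: `flowDeriv m s s y = id` (`IsFlow`: `disp m s s = ∫_s^s … = 0`). [folklore] -/
theorem flowDeriv_self (E : LagrangianLatticeCarrier k) {m : ℕ} (hF : E.IsFlow m) (s : ℝ) (y : UnitAddTorus (Fin 3)) :
    E.flowDeriv m s s y = ContinuousLinearMap.id ℝ (EuclideanSpace ℝ (Fin 3)) := by
  have h0 : Torus.lift (E.disp m s s) = fun _ => (0 : EuclideanSpace ℝ (Fin 3)) := by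
    funext z
    simp only [Torus.lift, Function.comp_apply]
    rw [hF s s]
    exact intervalIntegral.integral_same
  rw [LagrangianLatticeCarrier.flowDeriv, h0]
  simp

/-- `frameJac E m s s y = 1`. [folklore] -/
theorem frameJac_self (E : LagrangianLatticeCarrier k) {m : ℕ} (hF : E.IsFlow m) (s : ℝ) (y : UnitAddTorus (Fin 3)) :
    frameJac E m s s y = 1 := by
  ext a c
  rw [frameJac, Matrix.of_apply, flowDeriv_self E hF s y, ContinuousLinearMap.id_apply, PiLp.single_apply, Matrix.one_apply]

/-- `frameG E m s s y = 1`. [folklore] -/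
theorem frameG_self (E : LagrangianLatticeCarrier k) {m : ℕ} (hF : E.IsFlow m) (s : ℝ) (y : UnitAddTorus (Fin 3)) :
    frameG E m s s y = 1 := by
  rw [frameG, frameJac_self E hF s y, inv_one]

/-! ## §2 Determinant, adjugate form and smoothness on a refresh window -/

section Window

/-- On a refresh window `det (frameJac) = 1` (Liouville; `LevelRegular.det_flowDeriv_eq_one`). -/
theorem det_frameJac_eq_one (E : LagrangianLatticeCarrier k) (hR : E.LevelRegular) {m : ℕ} (hF : E.IsFlow m) (j : ℤ) {T : ℝ}
    (hT : T < E.refresh (m + 1)) {u : ℝ} (hu : u ∈ Icc 0 T) (y : UnitAddTorus (Fin 3)) :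
    (frameJac E m ((j : ℝ) * E.refresh (m + 1) + u) ((j : ℝ) * E.refresh (m + 1)) y).det = 1 := by
  rw [frameJac_eq_of]
  exact hR.det_flowDeriv_eq_one hF j hT hu y

/-- On a refresh window `det (frameG) = 1`. -/
theorem det_frameG_eq_one (E : LagrangianLatticeCarrier k) (hR : E.LevelRegular) {m : ℕ} (hF : E.IsFlow m) (j : ℤ) {T : ℝ}
    (hT : T < E.refresh (m + 1)) {u : ℝ} (hu : u ∈ Icc 0 T) (y : UnitAddTorus (Fin 3)) :
    (frameG E m ((j : ℝ) * E.refresh (m + 1) + u) ((j : ℝ) * E.refresh (m + 1)) y).det = 1 := by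
  rw [frameG, Matrix.det_nonsing_inv, det_frameJac_eq_one E hR hF j hT hu y, Ring.inverse_one]

/-- On a refresh window `frameG = adj (frameJac)` (`LevelRegular.inv_flowDeriv_matrix_eq_adjugate`). -/
theorem frameG_eq_adjugate (E : LagrangianLatticeCarrier k) (hR : E.LevelRegular) {m : ℕ} (hF : E.IsFlow m) (j : ℤ) {T : ℝ}
    (hT : T < E.refresh (m + 1)) {u : ℝ} (hu : u ∈ Icc 0 T) (y : UnitAddTorus (Fin 3)) :
    frameG E m ((j : ℝ) * E.refresh (m + 1) + u) ((j : ℝ) * E.refresh (m + 1)) y =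
      (frameJac E m ((j : ℝ) * E.refresh (m + 1) + u) ((j : ℝ) * E.refresh (m + 1)) y).adjugate := by
  rw [frameG, frameJac_eq_of]
  exact hR.inv_flowDeriv_matrix_eq_adjugate hF j hT hu y

/-- Every entry of `frameJac` is a smooth function of the label (`LevelRegular.isSmooth_flowDeriv_entry`). -/
theorem isSmooth_frameJac_entry (E : LagrangianLatticeCarrier k) (hR : E.LevelRegular) {m : ℕ} (j : ℤ) (u : ℝ) (a c : Fin 3) :
    Torus.IsSmooth (fun y => frameJac E m ((j : ℝ) * E.refresh (m + 1) + u) ((j : ℝ) * E.refresh (m + 1)) y a c) := by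
  simp only [frameJac, Matrix.of_apply]
  exact hR.isSmooth_flowDeriv_entry m j u a c

/-- Every entry of the adjugate of `frameJac` is a smooth function of the label (a polynomial in smooth entries, `Matrix.adjugate_fin_three`). -/
theorem isSmooth_adjugate_frameJac_entry (E : LagrangianLatticeCarrier k) (hR : E.LevelRegular) {m : ℕ} (j : ℤ) (u : ℝ) (i l : Fin 3) :
    Torus.IsSmooth (fun y => (frameJac E m ((j : ℝ) * E.refresh (m + 1) + u) ((j : ℝ) * E.refresh (m + 1)) y).adjugate i l) := by
  have h : ∀ a c : Fin 3, ContDiff ℝ (⊤ : ℕ∞)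
      (fun z : EuclideanSpace ℝ (Fin 3) => frameJac E m ((j : ℝ) * E.refresh (m + 1) + u) ((j : ℝ) * E.refresh (m + 1)) (Torus.proj z) a c) :=
    fun a c => isSmooth_frameJac_entry E hR j u a c
  unfold Torus.IsSmooth Torus.lift
  simp only [Function.comp_def, Matrix.adjugate_fin_three]
  fin_cases i <;> fin_cases l <;>
    simp only [Fin.zero_eta, Fin.mk_one, Fin.reduceFinMk, Matrix.of_apply, Matrix.cons_val', Matrix.cons_val_zero,
      Matrix.cons_val_one, Matrix.cons_val_two, Matrix.cons_val_fin_one, Matrix.empty_val', Matrix.head_cons, Matrix.tail_cons,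
      Matrix.head_fin_const] <;>
    fun_prop

/-- On a refresh window every entry of `frameG` is a smooth function of the label. -/
theorem isSmooth_frameG_entry (E : LagrangianLatticeCarrier k) (hR : E.LevelRegular) {m : ℕ} (hF : E.IsFlow m) (j : ℤ) {T : ℝ}
    (hT : T < E.refresh (m + 1)) {u : ℝ} (hu : u ∈ Icc 0 T) (i l : Fin 3) :
    Torus.IsSmooth (fun y => frameG E m ((j : ℝ) * E.refresh (m + 1) + u) ((j : ℝ) * E.refresh (m + 1)) y i l) := by
  have e : (fun y => frameG E m ((j : ℝ) * E.refresh (m + 1) + u) ((j : ℝ) * E.refresh (m + 1)) y i l) =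
      fun y => (frameJac E m ((j : ℝ) * E.refresh (m + 1) + u) ((j : ℝ) * E.refresh (m + 1)) y).adjugate i l := by
    funext y; rw [frameG_eq_adjugate E hR hF j hT hu y]
  rw [e]
  exact isSmooth_adjugate_frameJac_entry E hR j u i l

/-! ## §3 The frame equation: a uniform rate bound on the window -/

/-- **Rate bound from the frame equation.**  If on the window `|G − 1| ≤ θ` entrywise and `|∂_l b_{≤m,q}(s+u, X(u,y))| ≤ Cb`, then every entry
of `u ↦ adj (frameJac)(u, y)` has derivative within `[0, T]` of size `≤ 3(1+θ)·Cb` (`∂_u G = −G·(∇b_{≤m}∘X)`,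
`LevelRegular.hasDerivWithinAt_adjugate_flowDeriv_entry`). -/
theorem norm_deriv_adjugate_le (E : LagrangianLatticeCarrier k) (hR : E.LevelRegular) {m : ℕ} (hF : E.IsFlow m) (j : ℤ) {T : ℝ}
    (hT : T < E.refresh (m + 1)) (hT0 : 0 < T) {θ Cb : ℝ} (hθ : 0 ≤ θ)
    (hnear : ∀ u ∈ Icc 0 T, ∀ (y : UnitAddTorus (Fin 3)) (i l : Fin 3),
      |frameG E m ((j : ℝ) * E.refresh (m + 1) + u) ((j : ℝ) * E.refresh (m + 1)) y i l - (1 : Matrix (Fin 3) (Fin 3) ℝ) i l| ≤ θ)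
    (hrate : ∀ u ∈ Icc 0 T, ∀ (y : UnitAddTorus (Fin 3)) (a q : Fin 3),
      |Torus.partialDeriv q (fun z => E.partialSum m ((j : ℝ) * E.refresh (m + 1) + u) z a)
        (E.X m ((j : ℝ) * E.refresh (m + 1) + u) ((j : ℝ) * E.refresh (m + 1)) y)| ≤ Cb)
    {u : ℝ} (hu : u ∈ Icc 0 T) (y : UnitAddTorus (Fin 3)) (i l : Fin 3) :
    ∃ D : ℝ, HasDerivWithinAt
        (fun u => (frameJac E m ((j : ℝ) * E.refresh (m + 1) + u) ((j : ℝ) * E.refresh (m + 1)) y).adjugate i l) D (Icc 0 T) u ∧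
      ‖D‖ ≤ 3 * (1 + θ) * Cb := by
  have hD := hR.hasDerivWithinAt_adjugate_flowDeriv_entry hF j hT hT0 hu y i l
  refine ⟨_, by simpa only [frameJac_eq_of] using hD, ?_⟩
  -- the derivative is `-(adj J * B) i l = -Σ_q G_{iq} B_{ql}`
  rw [norm_neg, Matrix.mul_apply, Real.norm_eq_abs]
  have hG : ∀ q, |(frameJac E m ((j : ℝ) * E.refresh (m + 1) + u) ((j : ℝ) * E.refresh (m + 1)) y).adjugate i q| ≤ 1 + θ := by
    intro q
    have h1 := hnear u hu y i q
    rw [frameG_eq_adjugate E hR hF j hT hu y] at h1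
    have hδ : |(1 : Matrix (Fin 3) (Fin 3) ℝ) i q| ≤ 1 := by
      rw [Matrix.one_apply]; split_ifs <;> simp
    calc |(frameJac E m _ _ y).adjugate i q|
        = |((frameJac E m _ _ y).adjugate i q - (1 : Matrix (Fin 3) (Fin 3) ℝ) i q) + (1 : Matrix (Fin 3) (Fin 3) ℝ) i q| := by
          rw [sub_add_cancel]
      _ ≤ |(frameJac E m _ _ y).adjugate i q - (1 : Matrix (Fin 3) (Fin 3) ℝ) i q| + |(1 : Matrix (Fin 3) (Fin 3) ℝ) i q| :=
          abs_add_le _ _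
      _ ≤ θ + 1 := add_le_add h1 hδ
      _ = 1 + θ := add_comm _ _
  have hB : ∀ q, |(Matrix.of fun a q => Torus.partialDeriv q (fun z => E.partialSum m ((j : ℝ) * E.refresh (m + 1) + u) z a)
      (E.X m ((j : ℝ) * E.refresh (m + 1) + u) ((j : ℝ) * E.refresh (m + 1)) y)) q l| ≤ Cb := fun q => by
    rw [Matrix.of_apply]; exact hrate u hu y q l
  rw [frameJac_eq_of] at hG
  calc |∑ q, (Matrix.of fun a c => (E.flowDeriv m ((j : ℝ) * E.refresh (m + 1) + u) ((j : ℝ) * E.refresh (m + 1)) y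
            (EuclideanSpace.single c (1 : ℝ))) a).adjugate i q *
          (Matrix.of fun a q => Torus.partialDeriv q (fun z => E.partialSum m ((j : ℝ) * E.refresh (m + 1) + u) z a)
            (E.X m ((j : ℝ) * E.refresh (m + 1) + u) ((j : ℝ) * E.refresh (m + 1)) y)) q l|
      ≤ ∑ q, |(Matrix.of fun a c => (E.flowDeriv m ((j : ℝ) * E.refresh (m + 1) + u) ((j : ℝ) * E.refresh (m + 1)) y
            (EuclideanSpace.single c (1 : ℝ))) a).adjugate i q *
          (Matrix.of fun a q => Torus.partialDeriv q (fun z => E.partialSum m ((j : ℝ) * E.refresh (m + 1) + u) z a)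
            (E.X m ((j : ℝ) * E.refresh (m + 1) + u) ((j : ℝ) * E.refresh (m + 1)) y)) q l| := Finset.abs_sum_le_sum_abs _ _
    _ ≤ ∑ _q : Fin 3, (1 + θ) * Cb := Finset.sum_le_sum fun q _ => by
          rw [abs_mul]
          exact mul_le_mul (hG q) (hB q) (abs_nonneg _) (by linarith)
    _ = 3 * (1 + θ) * Cb := by simp [Finset.sum_const]; ring

end Window

/-! ## §4 The modulation structure of the exact-flow frame -/

/-- **THE EXACT-FLOW FRAME IS A MODULATION** (L5-0, fields (i)(ii) of lead-k1l-onelevel-p1 g5's spec, memo L12 §5).  On the refresh window of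
level `m+1` starting at `s = j·refresh (m+1)`, for a piece end `t` with `s < t`, `t − s < refresh (m+1)`, the datum
`G τ y := frameG E m (s + τ / E.a (m+1)) s y` satisfies `CellClauseMod.IsModulation θ (E.a (m+1)·(t − s)) nC G`, GIVEN on the window:
`hnear` (`|G − 1| ≤ θ`), `hrate` (`|∂_l b_{≤m,q}(s+u, X(u,y))| ≤ Cb`) with the budget `hbudget` (`3(1+θ)·Cb·(t−s) ≤ θ`), `hpiola` (columns of `G`
divergence-free) and `hcurv` (`|∂_c G_{il}| ≤ θ·nC`).  Proved fields: `init`, `det_one`, `smooth`, `lipschitz`, `tvar` (and the three hypotheses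
re-timed to cell time `τ = a·u`). -/
theorem isModulation_frameG_of (E : LagrangianLatticeCarrier k) (hR : E.LevelRegular) {m : ℕ} (hF : E.IsFlow m) (j : ℤ)
    {t : ℝ} (hst : (j : ℝ) * E.refresh (m + 1) < t) (htR : t - (j : ℝ) * E.refresh (m + 1) < E.refresh (m + 1))
    {θ nC Cb : ℝ} (hθ : 0 ≤ θ) (hCb : 0 ≤ Cb)
    (hnear : ∀ u ∈ Icc 0 (t - (j : ℝ) * E.refresh (m + 1)), ∀ (y : UnitAddTorus (Fin 3)) (i l : Fin 3),
      |frameG E m ((j : ℝ) * E.refresh (m + 1) + u) ((j : ℝ) * E.refresh (m + 1)) y i l - (1 : Matrix (Fin 3) (Fin 3) ℝ) i l| ≤ θ)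
    (hrate : ∀ u ∈ Icc 0 (t - (j : ℝ) * E.refresh (m + 1)), ∀ (y : UnitAddTorus (Fin 3)) (a q : Fin 3),
      |Torus.partialDeriv q (fun z => E.partialSum m ((j : ℝ) * E.refresh (m + 1) + u) z a)
        (E.X m ((j : ℝ) * E.refresh (m + 1) + u) ((j : ℝ) * E.refresh (m + 1)) y)| ≤ Cb)
    (hbudget : 3 * (1 + θ) * Cb * (t - (j : ℝ) * E.refresh (m + 1)) ≤ θ)
    (hpiola : ∀ u ∈ Icc 0 (t - (j : ℝ) * E.refresh (m + 1)), ∀ i : Fin 3,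
      Torus.IsDivFree (fun y => (WithLp.toLp 2 fun c => frameG E m ((j : ℝ) * E.refresh (m + 1) + u) ((j : ℝ) * E.refresh (m + 1)) y c i :
        EuclideanSpace ℝ (Fin 3))))
    (hcurv : ∀ u ∈ Icc 0 (t - (j : ℝ) * E.refresh (m + 1)), ∀ (y : UnitAddTorus (Fin 3)) (i l c : Fin 3),
      |Torus.partialDeriv c (fun y => frameG E m ((j : ℝ) * E.refresh (m + 1) + u) ((j : ℝ) * E.refresh (m + 1)) y i l) y| ≤ θ * nC) :
    CellClauseMod.IsModulation θ (E.a (m + 1) * (t - (j : ℝ) * E.refresh (m + 1))) nC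
      (fun τ y => frameG E m ((j : ℝ) * E.refresh (m + 1) + τ / E.a (m + 1)) ((j : ℝ) * E.refresh (m + 1)) y) := by
  set s : ℝ := (j : ℝ) * E.refresh (m + 1) with hs
  set T : ℝ := t - s with hTdef
  set a : ℝ := E.a (m + 1) with ha
  have ha0 : 0 < a := E.toFractalCarrierData.a_pos (m + 1)
  have hT0 : 0 < T := by rw [hTdef]; linarith
  have hTR : T < E.refresh (m + 1) := htR
  -- cell time ↦ window time
  have hmem : ∀ τ ∈ Icc 0 (a * T), τ / a ∈ Icc 0 T := by
    intro τ hτ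
    refine ⟨div_nonneg hτ.1 ha0.le, ?_⟩
    rw [div_le_iff₀ ha0]; linarith [hτ.2, mul_comm a T]
  -- the uniform rate bound on the window, and its two consequences
  set C : ℝ := 3 * (1 + θ) * Cb with hC
  have hC0 : 0 ≤ C := by rw [hC]; positivity
  have hderiv : ∀ (y : UnitAddTorus (Fin 3)) (i l : Fin 3), ∀ u ∈ Icc 0 T, ∃ D : ℝ, HasDerivWithinAt
      (fun u => (frameJac E m (s + u) s y).adjugate i l) D (Icc 0 T) u ∧ ‖D‖ ≤ C :=
    fun y i l u hu => norm_deriv_adjugate_le E hR hF j hTR hT0 hθ hnear hrate hu y i l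
  -- mean value: the adjugate entries are `C`-Lipschitz in window time
  have hMV : ∀ (y : UnitAddTorus (Fin 3)) (i l : Fin 3), ∀ u₁ ∈ Icc 0 T, ∀ u₂ ∈ Icc 0 T,
      |(frameJac E m (s + u₂) s y).adjugate i l - (frameJac E m (s + u₁) s y).adjugate i l| ≤ C * |u₂ - u₁| := by
    intro y i l u₁ hu₁ u₂ hu₂
    choose D hD using hderiv y i l
    have h := Convex.norm_image_sub_le_of_norm_hasDerivWithin_le (f := fun u => (frameJac E m (s + u) s y).adjugate i l)
      (f' := fun u => if hu : u ∈ Icc 0 T then D u hu else 0) (s := Icc 0 T) (C := C)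
      (fun u hu => by simpa only [dif_pos hu] using (hD u hu).1)
      (fun u hu => by simpa only [dif_pos hu] using (hD u hu).2) (convex_Icc 0 T) hu₁ hu₂
    simpa only [Real.norm_eq_abs] using h
  -- `G τ` in terms of the adjugate, on the cell-time window
  have hGadj : ∀ τ ∈ Icc 0 (a * T), ∀ (y : UnitAddTorus (Fin 3)) (i l : Fin 3),
      frameG E m (s + τ / a) s y i l = (frameJac E m (s + τ / a) s y).adjugate i l := by
    intro τ hτ y i l
    rw [frameG_eq_adjugate E hR hF j hTR (hmem τ hτ) y]
  refine ⟨?_, ?_, ?_, ?_, ?_, ?_, ?_, ?_⟩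
  · -- init
    intro y
    show frameG E m (s + 0 / a) s y = 1
    rw [zero_div, add_zero]
    exact frameG_self E hF s y
  · -- near_one
    intro τ hτ y i l
    exact hnear (τ / a) (hmem τ hτ) y i l
  · -- det_one
    intro τ hτ y
    exact det_frameG_eq_one E hR hF j hTR (hmem τ hτ) y
  · -- piola
    intro τ hτ i
    exact hpiola (τ / a) (hmem τ hτ) i
  · -- smooth
    intro τ hτ i l
    exact isSmooth_frameG_entry E hR hF j hTR (hmem τ hτ) i l
  · -- grad_le
    intro τ hτ y i l c
    exact hcurv (τ / a) (hmem τ hτ) y i l c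
  · -- lipschitz, constant `C / a`
    refine ⟨Real.toNNReal (C / a), fun y i l => ?_⟩
    refine LipschitzOnWith.of_dist_le_mul fun τ₁ hτ₁ τ₂ hτ₂ => ?_
    rw [Real.dist_eq, Real.dist_eq, Real.coe_toNNReal _ (div_nonneg hC0 ha0.le), hGadj τ₁ hτ₁ y i l, hGadj τ₂ hτ₂ y i l]
    have h := hMV y i l (τ₂ / a) (hmem τ₂ hτ₂) (τ₁ / a) (hmem τ₁ hτ₁)
    calc |(frameJac E m (s + τ₁ / a) s y).adjugate i l - (frameJac E m (s + τ₂ / a) s y).adjugate i l|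
        ≤ C * |τ₁ / a - τ₂ / a| := h
      _ = C / a * |τ₁ - τ₂| := by
          rw [← sub_div, abs_div, abs_of_pos ha0]; ring
  · -- tvar, constant rate `C / a`, total mass `C·T ≤ θ`
    refine ⟨fun _ => C / a, fun _ => div_nonneg hC0 ha0.le, ?_, ?_, ?_⟩
    · exact (continuous_const).integrableOn_Icc
    · rw [setIntegral_const, Real.volume_real_Icc_of_le (mul_nonneg ha0.le hT0.le), sub_zero, smul_eq_mul]
      calc a * T * (C / a) = C * T := by field_simp
        _ ≤ θ := by rw [hC, hTdef]; exact hbudget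
    · intro y i l τ₁ hτ₁ τ₂ hτ₂ h12
      rw [setIntegral_const, Real.volume_real_Icc_of_le h12, smul_eq_mul,
        hGadj τ₁ hτ₁ y i l, hGadj τ₂ hτ₂ y i l]
      have h := hMV y i l (τ₁ / a) (hmem τ₁ hτ₁) (τ₂ / a) (hmem τ₂ hτ₂)
      calc |(frameJac E m (s + τ₂ / a) s y).adjugate i l - (frameJac E m (s + τ₁ / a) s y).adjugate i l|
          ≤ C * |τ₂ / a - τ₁ / a| := h
        _ = (τ₂ - τ₁) * (C / a) := by
            rw [← sub_div, abs_div, abs_of_pos ha0, abs_of_nonneg (by linarith)]; ring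

end Summit.AnomalousDissipation.AnomalousDissipation.Theorems.SolenoidalFractalHomogenisation.LagrangianStep.FrameForm

end
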